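import Mathlib.MeasureTheory.Measure.Lebesgue.EqHaar
import Summits.AtomisticToContinuum.Crystallization.Theorems.FreeSplittingCertificatesStrictSplittingRuleFarPencilSplitWeight

/-!
# `StrictSplittingRule` (stmt-AtomisticToContinuum-12560): discharging the hypotheses of the P1-class far theorem — null faces, local affinity, affine tail, the ledger's weight

Route `FreeSplittingCertificates`, crux r3 `StrictSplittingRule` (H12⋆ = `stub_coreJointCoercive`), unit b2b-freesplit-B gen 18.
VALUE = bookkeeping lemmas for item (2) of HOME FAR-LEMMA-SPEC §15 (d) (the P1 interpolant OBJECT): the far half of the assembly is the single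
theorem `farPencil4_weighted_integral_le_of_locallyAffine` (`…FarPencilFlux4LocallyAffine`), whose hypotheses on the interpolated field `v` are
(i) `LipschitzWith K v`, (ii) `volume S = 0`, (iii) `v` affine on a ball around every `x ∉ S`, (iv) an affine tail, plus three weight hypotheses.
Here: (ii) for `S` inside a countable union of proper affine subspaces (the planes of the element faces: `Measure.addHaar_affineSubspace`);
(iii) from "affine on each cell of a cover whose frontiers lie in `S`"; (iv) from `EqOn` on the tail region; and the weight hypotheses are
those of the ledger's split weight `fpChi R₁² R₂²` (`…FarPencilSplitWeight`), giving `farPencil4_weighted_integral_le_fpChi` for ANY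
pointwise certificate (+ instance B; instance D is `farPencilD_weighted_integral_le_fpChi`).  (i) — Lipschitz continuity of a continuous
cellwise-affine field — is left to the interpolant file (it needs the mesh's local finiteness).  NOT a proof of H12⋆, NOT summit progress.
-/

noncomputable section

open MeasureTheory Topology Filter Set Metric
open scoped NNReal

namespace Summit.AtomisticToContinuum.Crystallization.Theorems.StrictSplittingRuleBirth

/-- A countable union of proper affine subspaces of `ℝ³` (e.g. the planes carrying the faces of a locally finite polyhedral mesh) is
Lebesgue-null — the `volume S = 0` hypothesis of `farPencil4_weighted_integral_le_of_locallyAffine` for `S` = the element faces. -/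
theorem volume_iUnion_affineSubspace_eq_zero {ι : Type*} [Countable ι] (P : ι → AffineSubspace ℝ (Fin 3 → ℝ))
    (hP : ∀ i, P i ≠ ⊤) : volume (⋃ i, (P i : Set (Fin 3 → ℝ))) = 0 := by
  refine measure_iUnion_null fun i => ?_
  exact Measure.addHaar_affineSubspace volume (P i) (hP i)

/-- Any set contained in a countable union of proper affine subspaces is null. -/
theorem volume_eq_zero_of_subset_iUnion_affineSubspace {ι : Type*} [Countable ι] (P : ι → AffineSubspace ℝ (Fin 3 → ℝ))
    (hP : ∀ i, P i ≠ ⊤) {S : Set (Fin 3 → ℝ)} (hS : S ⊆ ⋃ i, (P i : Set (Fin 3 → ℝ))) : volume S = 0 :=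
  measure_mono_null hS (volume_iUnion_affineSubspace_eq_zero P hP)

/-- **Local affinity off the faces.**  If `v` is affine on each cell of a cover of `ℝ³` (`v y = c_i + L_i y` on `cells i`) and `S` contains the
frontier of every cell, then at every `x ∉ S` the field `v` coincides with an affine map on a ball around `x` — the `hloc` hypothesis of
`farPencil4_weighted_integral_le_of_locallyAffine`. -/
theorem locallyAffine_of_cellwise_affine {ι : Type*} {v : (Fin 3 → ℝ) → (Fin 3 → ℝ)} {cells : ι → Set (Fin 3 → ℝ)}
    {S : Set (Fin 3 → ℝ)} (hcover : ∀ x, ∃ i, x ∈ cells i)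
    (haff : ∀ i, ∃ (c : Fin 3 → ℝ) (L : (Fin 3 → ℝ) →L[ℝ] (Fin 3 → ℝ)), ∀ y ∈ cells i, v y = c + L y)
    (hS : ∀ i, frontier (cells i) ⊆ S) :
    ∀ x, x ∉ S → ∃ r > 0, ∃ L : (Fin 3 → ℝ) →L[ℝ] (Fin 3 → ℝ), ∀ y ∈ ball x r, v y = v x + L (y - x) := by
  intro x hx
  obtain ⟨i, hi⟩ := hcover x
  obtain ⟨c, L, hL⟩ := haff i
  have hint : x ∈ interior (cells i) := by
    rw [← self_sdiff_frontier]
    exact ⟨hi, fun h => hx (hS i h)⟩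
  obtain ⟨r, hr, hball⟩ := Metric.isOpen_iff.1 isOpen_interior x hint
  refine ⟨r, hr, L, fun y hy => ?_⟩
  have hy' : y ∈ cells i := interior_subset (hball hy)
  rw [hL y hy', hL x hi, map_sub]
  abel

/-- The same with cells given as a set family covering `univ`. -/
theorem locallyAffine_of_cellwise_affine' {ι : Type*} {v : (Fin 3 → ℝ) → (Fin 3 → ℝ)} {cells : ι → Set (Fin 3 → ℝ)}
    {S : Set (Fin 3 → ℝ)} (hcover : (⋃ i, cells i) = univ)
    (haff : ∀ i, ∃ (c : Fin 3 → ℝ) (L : (Fin 3 → ℝ) →L[ℝ] (Fin 3 → ℝ)), ∀ y ∈ cells i, v y = c + L y)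
    (hS : ∀ i, frontier (cells i) ⊆ S) :
    ∀ x, x ∉ S → ∃ r > 0, ∃ L : (Fin 3 → ℝ) →L[ℝ] (Fin 3 → ℝ), ∀ y ∈ ball x r, v y = v x + L (y - x) := by
  refine locallyAffine_of_cellwise_affine (fun x => ?_) haff hS
  have hx : x ∈ ⋃ i, cells i := by rw [hcover]; exact mem_univ x
  simpa using hx

/-- **Affine tail from cellwise data.**  If `v y = b₀ + y·A` on every cell that meets `{‖y‖ ≥ R}` … stated directly: a field that agrees with
the affine map `y ↦ b₀ + y·A` on `{y | R ≤ ‖y‖}` satisfies the `htail` hypothesis verbatim (bookkeeping lemma for the interpolant of a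
finitely supported lattice displacement co-rotated to its far field). -/
theorem affineTail_of_eqOn {v : (Fin 3 → ℝ) → (Fin 3 → ℝ)} {R : ℝ} {b₀ : Fin 3 → ℝ} {A : Fin 3 → Fin 3 → ℝ}
    (h : EqOn v (fun y j => b₀ j + (y 0 * A 0 j + y 1 * A 1 j + y 2 * A 2 j)) {y | R ≤ ‖y‖}) :
    ∀ y : Fin 3 → ℝ, R ≤ ‖y‖ → ∀ j, v y j = b₀ j + (y 0 * A 0 j + y 1 * A 1 j + y 2 * A 2 j) := by
  intro y hy j
  have := h hy
  exact congrFun this j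

/-- **The far half for ANY pointwise certificate with the ledger's split weight** `χ = fpChi R₁² R₂²` (`0 < R₁ < R₂`): for `v` `K`-Lipschitz,
locally affine off a null set `S` and affine for `‖y‖ ≥ R`, and a certificate `N(f_S,f_A,D,C) + div(aΦ₁+bΦ₂+cΦ₃+nΨ₁) ≤ t·Den` at every `x ≠ 0`:
`∫ χ²·N(v) ≤ t·∫ χ²·Den(v) + ∫ 2χ⟪∇χ, Φ(v)⟫`.  NOT a proof of H12⋆, NOT summit progress. -/
theorem farPencil4_weighted_integral_le_fpChi {fS fA D C a b c n t : ℝ}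
    (hcert : ∀ (x w : Fin 3 → ℝ) (G : Fin 3 → Fin 3 → ℝ), x ≠ 0 → fpNumI fS fA D C x w G + fpDivFlux4 a b c n x w G ≤ t * fpDen x G)
    {v : (Fin 3 → ℝ) → (Fin 3 → ℝ)} {K : ℝ≥0} {R R1 R2 : ℝ} {b₀ : Fin 3 → ℝ} {A : Fin 3 → Fin 3 → ℝ} {S : Set (Fin 3 → ℝ)}
    (hR1 : 0 < R1) (hR12 : R1 < R2) (hv : LipschitzWith K v) (hS : volume S = 0)
    (hloc : ∀ x, x ∉ S → ∃ r > 0, ∃ L : (Fin 3 → ℝ) →L[ℝ] (Fin 3 → ℝ), ∀ y ∈ ball x r, v y = v x + L (y - x))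
    (htail : ∀ y : Fin 3 → ℝ, R ≤ ‖y‖ → ∀ j, v y j = b₀ j + (y 0 * A 0 j + y 1 * A 1 j + y 2 * A 2 j)) :
    ∫ x, fpChi (R1 ^ 2) (R2 ^ 2) x ^ 2 * fpNumI fS fA D C x (v x) (fpGrad v x) ≤
      t * (∫ x, fpChi (R1 ^ 2) (R2 ^ 2) x ^ 2 * fpDen x (fpGrad v x)) +
        ∫ x, 2 * fpChi (R1 ^ 2) (R2 ^ 2) x * fpFlux4DotGrad a b c n v (fpChi (R1 ^ 2) (R2 ^ 2)) x := by
  have hlt : R1 ^ 2 < R2 ^ 2 := by nlinarith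
  have hR2 : 0 ≤ R2 := by linarith
  have htail' : ∀ y : Fin 3 → ℝ, max R R2 ≤ ‖y‖ → ∀ j, v y j = b₀ j + (y 0 * A 0 j + y 1 * A 1 j + y 2 * A 2 j) :=
    fun y hy j => htail y ((le_max_left _ _).trans hy) j
  have hχ1 : ∀ y : Fin 3 → ℝ, max R R2 ≤ ‖y‖ → fpChi (R1 ^ 2) (R2 ^ 2) y = 1 :=
    fun y hy => fpChi_eq_one_of_norm_ge hlt hR2 le_rfl y ((le_max_right _ _).trans hy)
  exact farPencil4_weighted_integral_le_of_locallyAffine hcert hv hS hloc (contDiff_two_fpChi _ _)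
    (zero_notMem_tsupport_fpChi (by positivity) hlt) htail' hχ1

/-- **Instance: the conservative certificate B with the ledger's weight** (`t = 27/50`, flux `(259/720, 1111/720, −413/360, 247/1800)`; the
all-kernel route via the base-radius inflation bound `h1_tau_inflation_num`).  NOT a proof of H12⋆, NOT summit progress. -/
theorem farPencilB_weighted_integral_le_fpChi {v : (Fin 3 → ℝ) → (Fin 3 → ℝ)} {K : ℝ≥0} {R R1 R2 : ℝ}
    {b₀ : Fin 3 → ℝ} {A : Fin 3 → Fin 3 → ℝ} {S : Set (Fin 3 → ℝ)} (hR1 : 0 < R1) (hR12 : R1 < R2)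
    (hv : LipschitzWith K v) (hS : volume S = 0)
    (hloc : ∀ x, x ∉ S → ∃ r > 0, ∃ L : (Fin 3 → ℝ) →L[ℝ] (Fin 3 → ℝ), ∀ y ∈ ball x r, v y = v x + L (y - x))
    (htail : ∀ y : Fin 3 → ℝ, R ≤ ‖y‖ → ∀ j, v y j = b₀ j + (y 0 * A 0 j + y 1 * A 1 j + y 2 * A 2 j)) :
    ∫ x, fpChi (R1 ^ 2) (R2 ^ 2) x ^ 2 * fpNumI (16 / 5) (16 / 5) (5 / 4) (3 / 4) x (v x) (fpGrad v x) ≤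
      27 / 50 * (∫ x, fpChi (R1 ^ 2) (R2 ^ 2) x ^ 2 * fpDen x (fpGrad v x)) +
        ∫ x, 2 * fpChi (R1 ^ 2) (R2 ^ 2) x *
          fpFlux4DotGrad (259 / 720) (1111 / 720) (-(413 / 360)) (247 / 1800) v (fpChi (R1 ^ 2) (R2 ^ 2)) x :=
  farPencil4_weighted_integral_le_fpChi farPencilCert_B hR1 hR12 hv hS hloc htail

end Summit.AtomisticToContinuum.Crystallization.Theorems.StrictSplittingRuleBirth
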